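/-
Origin: expansion seat `planner-pub-hodgecm-pv14-0`, handover 2026-08-18T03:54:27Z (`HOME/pub-hodgecm-pv14/lean/Pv14/PerL34/P36AbsConv.lean`, md5 d4d62862, 112 lines);
landed by the gen-5 packager in gate run 20 as `HodgeCM/PerL34/P36_absConv.lean` (verbatim).
-/
/-
Origin: HOME/pub-hodgecm-pv14/lean/Pv14/PerL34/P36AbsConv.lean — session planner-pub-hodgecm-pv14-0 (unit pub-hodgecm-pv14,
DAG-NODE PROVER #14).  Intended final place: `HodgeCM/PerL34/P36_absConv.lean`.
DAG node: **N23b** (PerL v5 Prop 3.6 `prop:isol` proof, Step 1, tex l. 413: "Unfolding (absolutely convergent: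
continuous functions, compact domains modulo the compact support of Ξ^χ_f)").  KERNEL, `import Mathlib` only,
nothing asserted.  It discharges the one analytic hypothesis `hint` of pv09's `HodgeCM.PerL34.P36Unfold.unfolding_identity`
(`Pv09/P36UnfoldStep1.lean`) — residual (a) of GAPS pv09-C1 / pv14-C2 RECONCILIATION — with the SAME expression.
-/
import Mathlib

set_option autoImplicit false

/-!
# N23b, Step 1 — absolute convergence of the unfolded integral (tex l. 413)

In the fundamental-domain model of pv09/pv15 (`U` = `U(W)(𝔸)` with left Haar measure `μ`, `T` = `T(𝔸)` with
Haar measure `ν`, `jT : T →* U`, `𝓕T ⊆ T` a fundamental domain for `T(L₀)` — of FINITE measure because `[T]` is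
compact —, `θ = θ_Φ(g,·)` BOUNDED (continuous on the compact `[U(W)]`), `f ∈ C_c(U(W)(𝔸))`, `χ` a unitary
character) the integrand of the unfolding,
`G(z,t) = θ(z) · f(t⁻¹ z) · χ(t)` on `U × 𝓕T`,
is integrable for `μ ⊗ ν|_{𝓕T}`: it is dominated by `C · |f(t⁻¹ z)|`, and by left invariance of `μ`
`∫_U |f(t⁻¹ z)| dμ(z) = ‖f‖₁` for every `t`, so the dominating function has integral `C · ν(𝓕T) · ‖f‖₁ < ∞`
(Tonelli in the form `integrable_prod_iff'`).  This is exactly PerL's parenthesis "absolutely convergent: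
continuous functions, compact domains modulo the compact support".

Main results:
* `integrable_unfold_integrand` — measurable bounded `θ`, `χ`, measurable integrable `f`, `ν 𝓕T < ∞` ⇒ pv09's `hint`;
* `integrable_unfold_integrand_of_continuous` — the PerL instance: `θ` continuous bounded, `f` continuous with
  compact support, `χ` continuous with `‖χ t‖ ≤ 1`.
-/

open MeasureTheory

namespace HodgeCM
namespace PerL34
namespace P36AbsConv

variable {U : Type*} [Group U] [MeasurableSpace U] [MeasurableMul₂ U] [MeasurableInv U]
variable {T : Type*} [Group T] [MeasurableSpace T]

/-- The integrand of the unfolded Step-1 integral, in pv09's notation: `G(z,t) = θ(z) · (f(t⁻¹z) · χ(t))`. -/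
def unfoldIntegrand (jT : T →* U) (θ f : U → ℂ) (χ : T → ℂ) : U × T → ℂ :=
  fun p => θ p.1 * (f ((jT p.2)⁻¹ * p.1) * χ p.2)

/-- (Ported verbatim from the HodgeCMPerL package; no docstring in the source.) -/
theorem measurable_shear (jT : T →* U) (hjT : Measurable jT) :
    Measurable fun p : U × T => (jT p.2)⁻¹ * p.1 :=
  ((hjT.comp measurable_snd).inv).mul measurable_fst

/-- (Ported verbatim from the HodgeCMPerL package; no docstring in the source.) -/
theorem measurable_unfoldIntegrand (jT : T →* U) (hjT : Measurable jT) {θ f : U → ℂ} {χ : T → ℂ}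
    (hθ : Measurable θ) (hf : Measurable f) (hχ : Measurable χ) :
    Measurable (unfoldIntegrand jT θ f χ) :=
  (hθ.comp measurable_fst).mul ((hf.comp (measurable_shear jT hjT)).mul (hχ.comp measurable_snd))

/-- The dominating function `(z,t) ↦ C · ‖f(t⁻¹ z)‖` is integrable on `U × 𝓕T`:
for each `t` its `U`-integral is `C · ‖f‖₁` (left invariance), and `ν(𝓕T) < ∞`. -/
theorem integrable_dominator (μ : Measure U) [μ.IsMulLeftInvariant] [SFinite μ] (ν : Measure T) [SFinite ν]
    (jT : T →* U) (hjT : Measurable jT) {𝓕T : Set T} (h𝓕T : ν 𝓕T < ⊤)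
    {f : U → ℂ} (hfm : Measurable f) (hfi : Integrable f μ) (C : ℝ) :
    Integrable (fun p : U × T => C * ‖f ((jT p.2)⁻¹ * p.1)‖) (μ.prod (ν.restrict 𝓕T)) := by
  haveI : IsFiniteMeasure (ν.restrict 𝓕T) := ⟨by simpa using h𝓕T⟩
  have hmeas : AEStronglyMeasurable (fun p : U × T => C * ‖f ((jT p.2)⁻¹ * p.1)‖)
      (μ.prod (ν.restrict 𝓕T)) :=
    (measurable_const.mul (hfm.comp (measurable_shear jT hjT)).norm).aestronglyMeasurable
  rw [integrable_prod_iff' hmeas]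
  constructor
  · refine ae_of_all _ fun t => ?_
    have h1 : Integrable (fun z => f ((jT t)⁻¹ * z)) μ := hfi.comp_mul_left (jT t)⁻¹
    exact h1.norm.const_mul C
  · -- `t ↦ ∫ ‖C‖·‖f(t⁻¹z)‖ dz` is the constant `‖C‖ · ∫ ‖f‖`
    have hconst : (fun t => ∫ z, ‖C * ‖f ((jT t)⁻¹ * z)‖‖ ∂μ) = fun _ => ‖C‖ * ∫ z, ‖f z‖ ∂μ := by
      funext t
      have : (fun z => ‖C * ‖f ((jT t)⁻¹ * z)‖‖) = fun z => ‖C‖ * ‖f ((jT t)⁻¹ * z)‖ := by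
        funext z; rw [norm_mul, norm_norm]
      rw [this, integral_const_mul, integral_mul_left_eq_self (fun z => ‖f z‖) (jT t)⁻¹]
    rw [hconst]
    exact integrable_const _

/-- **Absolute convergence of the unfolding (tex l. 413), general measurable form = pv09's `hint`.**
`θ`, `χ` measurable and bounded, `f` measurable and integrable, `ν(𝓕T) < ∞`, `μ` left invariant ⇒
`(z,t) ↦ θ(z)·(f(t⁻¹z)·χ(t))` is integrable on `μ ⊗ ν|_{𝓕T}`. -/
theorem integrable_unfold_integrand (μ : Measure U) [μ.IsMulLeftInvariant] [SFinite μ]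
    (ν : Measure T) [SFinite ν] (jT : T →* U) (hjT : Measurable jT) {𝓕T : Set T} (h𝓕T : ν 𝓕T < ⊤)
    {θ f : U → ℂ} {χ : T → ℂ} (hθm : Measurable θ) (hfm : Measurable f) (hχm : Measurable χ)
    (hfi : Integrable f μ) {Cθ Cχ : ℝ} (hθ : ∀ z, ‖θ z‖ ≤ Cθ) (hχ : ∀ t, ‖χ t‖ ≤ Cχ) :
    Integrable (fun p : U × T => θ p.1 * (f ((jT p.2)⁻¹ * p.1) * χ p.2)) (μ.prod (ν.restrict 𝓕T)) := by
  refine (integrable_dominator μ ν jT hjT h𝓕T hfm hfi (Cθ * Cχ)).mono'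
    (measurable_unfoldIntegrand jT hjT hθm hfm hχm).aestronglyMeasurable (ae_of_all _ fun p => ?_)
  have h0 : 0 ≤ Cθ := le_trans (norm_nonneg _) (hθ p.1)
  rw [norm_mul, norm_mul]
  calc ‖θ p.1‖ * (‖f ((jT p.2)⁻¹ * p.1)‖ * ‖χ p.2‖)
      ≤ Cθ * (‖f ((jT p.2)⁻¹ * p.1)‖ * Cχ) := by
        apply mul_le_mul (hθ p.1) _ (by positivity) h0
        exact mul_le_mul_of_nonneg_left (hχ p.2) (norm_nonneg _)
    _ = Cθ * Cχ * ‖f ((jT p.2)⁻¹ * p.1)‖ := by ring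

/-- **The PerL instance (tex l. 413: "continuous functions, compact domains modulo the compact support").**
`θ = θ_Φ(g,·)` continuous and bounded (it is continuous on the compact `[U(W)]`), `f ∈ C_c(U(W)(𝔸))`,
`χ` a continuous character with `‖χ t‖ ≤ 1`, `[T]` compact (`ν(𝓕T) < ∞`). -/
theorem integrable_unfold_integrand_of_continuous
    [TopologicalSpace U] [BorelSpace U] [IsTopologicalGroup U] [LocallyCompactSpace U]
    [TopologicalSpace T] [BorelSpace T]
    (μ : Measure U) [μ.IsMulLeftInvariant] [SFinite μ] [IsFiniteMeasureOnCompacts μ]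
    (ν : Measure T) [SFinite ν] (jT : T →* U) (hjT : Continuous jT) {𝓕T : Set T} (h𝓕T : ν 𝓕T < ⊤)
    {θ f : U → ℂ} {χ : T → ℂ} (hθc : Continuous θ) {Cθ : ℝ} (hθ : ∀ z, ‖θ z‖ ≤ Cθ)
    (hfc : Continuous f) (hfs : HasCompactSupport f) (hχc : Continuous χ) (hχ : ∀ t, ‖χ t‖ ≤ 1) :
    Integrable (fun p : U × T => θ p.1 * (f ((jT p.2)⁻¹ * p.1) * χ p.2)) (μ.prod (ν.restrict 𝓕T)) :=
  integrable_unfold_integrand μ ν jT hjT.measurable h𝓕T hθc.measurable hfc.measurable hχc.measurable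
    (hfc.integrable_of_hasCompactSupport hfs) hθ hχ

end P36AbsConv
end PerL34
end HodgeCM
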